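import Literature.NumberTheory.Automorphic.Liu2021.Def411WeilCarriersAtLineClassTransport
import HarnessLib

/-!
# (C′) `rhoAtLine_lineClassTransport` at rank `N′ = 0`: the line-class transport of `ω(μ, ε, χ)_f` for the EMPTY
# hermitian space `V` (the degenerate corner of the floor-0 programme P2's socket (C′))

Topic `NumberTheory/Automorphic/Liu2021`; namespaces `Literature.NumberTheory.GelbartRogawski1991.UnitaryDualPair.WeilCoinv`
(§1, generic) and `Literature.NumberTheory.Automorphic.Liu2021.Def411WeilCarriers` (§§2–3).  THEOREMS ONLY (no `def`, no
instance, no notation, no `sorry`, no named fact); imports = ★ `Def411WeilCarriersAtLineClassTransport` (the statement-only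
letter (C′) `rhoAtLine_lineClassTransport`, p793466) and `HarnessLib`.

WHY.  The letter (C′) quantifies over EVERY rank `N′` of the diagonal frame `dV : Fin N′ → L` (no guard `0 < N′`), while the
in-tree master transport of [F0P4] (`exists_omegaAtLine_equiv_rhoVAtLine_of_locF_eq…`, ★ p795153) is stated under `0 < N′`.
This file closes the remaining corner `N′ = 0` UNCONDITIONALLY (no hypothesis on the norm classes of `a, a′` is needed
there), so that the discharge `rhoAtLine_lineClassTransport_holds` is a case split on `N′` (F0P2-plan (g2) ruling R1,
2026-08-30T23:35Z; owner of the main branch F0P2-p02).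

MATHEMATICS (degenerate but honest).  For `N′ = 0` the index type `Fin 0 × Fin 1` of the symplectic space
`𝕎 = V ⊗ W` is empty, so the adelic pair group `U(J_V ⊗ J_W)(𝔸_{L⁺}) ≤ GL(Fin 0 × Fin 1, 𝔸_L)` is TRIVIAL; hence the pair
splitting `s_pair (k, u) = s(k ⊗ 1)·s(1 ⊗ u)` takes the value `1` for every compatible splitting `s` whatsoever
(`pairSmall₁_finPairToAdelic_eq_one`), the finite Weil representation `ω_f ∘ s_pair` of [Weil1964, n° 37–38] ∕
[GelbartRogawski1991, §3.1] on `𝒮(𝔸_f^{Fin 0 × Fin 1}) = 𝒮(point)` is the trivial representation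
(`finPairRep_eq_one_of_subsingleton`), and [Liu2021, App. D §D.1 Step 3]'s carrier `ω(μ, ε, χ)` at the line `⟨a⟩` — the
`χ_W`-coinvariants `𝒮(point) ⧸ span {ω_f(s_pair(1,u)) f − χ_W(u) f}` — has relation submodule `span {f − χ(u₀) f : u₀ ∈ U(1)(𝔸_f)}`
(`χ_W = χ ∘ (u₀·1_W ↦ u₀)`, ★ `lineChar_finAdelicCenter`), the SAME submodule for every line `a` (`ker_eq_ker_rankZero`).  So
the identity of `𝒮(point)` descends to a linear isomorphism `ω(μ, ε_a, χ) ≃ ω(μ, ε_{a′}, χ)` (Mathlib `Submodule.quotEquivOfEq`),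
trivially `G`-equivariant because `G` acts through `U(J_V)(𝔸_{L⁺,f}) ≤ GL(Fin 0, 𝔸_{L,f})`, again a trivial group
(`exists_intertwiningMap_injective_rankZero`); §3 is the `N′ = 0` instance of (C′)'s body, token for token
(`rhoAtLine_lineClassTransport_rankZero`).  Nothing here touches the content of (C′) at `0 < N′` ([Jacobowitz1962, Thm. 3.1];
[MVW1987, Ch. 3 §I]; [Kudla1994]; [HarrisKudlaSweet1996, §1]; [Flath1979, §2]), which is the master transport's.

HC_CM is proved only modulo the printed citations until rung 0 closes.

## References
* [Liu2021] Y. Liu, *Fourier–Jacobi cycles and arithmetic relative trace formula*, Camb. J. Math. 9 (2021) = arXiv:2102.11518: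
  Def. 4.11 (l. 2083–2097), App. D §D.1 Steps 2–3 (l. 5217–5221).
* [Weil1964] A. Weil, *Sur certains groupes d'opérateurs unitaires*, Acta Math. 111 (1964), Chap. III n° 37–38 pp. 188–190.
* [GelbartRogawski1991] S. Gelbart, J. Rogawski, Invent. Math. 105 (1991), §3.1 Prop. 3.1.1 p. 455, §3.1–3.2 pp. 454–457.
-/

noncomputable section

open NumberField IsDedekindDomain
open scoped Matrix Kronecker

/-! ## §1 The finite Weil representation of a dual pair whose adelic pair group is trivial is trivial -/

namespace Literature.NumberTheory.GelbartRogawski1991.UnitaryDualPair.WeilCoinv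

open Literature.NumberTheory.GelbartRogawski1991 Literature.NumberTheory.GelbartRogawski1991.UnitaryDualPair
open Literature.NumberTheory.Automorphic Literature.NumberTheory.Weil1964
open Literature.RepresentationTheory

variable (F E : Type) [Field F] [NumberField F] [Field E] [NumberField E] [Algebra F E]
variable (c : E ≃ₐ[F] E) (N M : ℕ) {n : ℕ} (e : Fin N × Fin M ≃ Fin n)
variable (JV : Matrix (Fin N) (Fin N) E) (JW : Matrix (Fin M) (Fin M) E)
variable {TV : Matrix (Fin N) (Fin N) F} {TW : Matrix (Fin M) (Fin M) F}

/-- **A splitting of a TRIVIAL adelic pair group has trivial pair splitting.**  If `U(J_V ⊗ J_W)(𝔸_F)` is a subsingleton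
(e.g. `N = 0` or `M = 0`: the index `Fin N × Fin M` is empty), then for every homomorphism `s : U(J_V ⊗ J_W)(𝔸_F) → Mp_ψ(𝕎_𝔸)ᶜᵒⁿᵗ`
the pair splitting `s_pair (k, u) = s(k ⊗ 1) · s(1 ⊗ u)` read back along `e` at the finite-adelic points is `1`.
[cite: GelbartRogawski1991, §3.1 Prop. 3.1.1 p. 455] [cite: Weil1964, Chap. III n° 37–38 pp. 188–190] -/
theorem pairSmall₁_finPairToAdelic_eq_one [Subsingleton ↥(UnitaryGroup.adelicPair F E c N M JV JW)]
    (s : UnitaryGroup.adelicPair F E c N M JV JW →* adelicMpCont F (Fin n) (adelicGram F e TV TW))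
    (q : UnitaryGroup.finAdelic F E c N JV × UnitaryGroup.finAdelic F E c M JW) :
    ((pairSmall₁ F E c N M e JV JW s).comp (finPairToAdelic F E c N M JV JW)) q = 1 := by
  have h1 : ∀ x : ↥(UnitaryGroup.adelicPair F E c N M JV JW), s x = 1 := fun x => by
    rw [Subsingleton.elim x 1, map_one]
  simp only [MonoidHom.comp_apply, pairSmall₁, pairSplitting_apply, h1, map_one]

variable [Algebra.IsQuadraticExtension F E] {δ : E} (hcδ : c δ = -δ) (hδ : δ ≠ 0) {d : F}
  (hd : δ * δ = algebraMap F E d) (hV : TV.IsSymm) (hW : TW.IsSymm) (hVd : IsUnit TV.det) (hWd : IsUnit TW.det)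
  (hJV : JV = TV.map (algebraMap F E)) (hJW : JW = TW.map (algebraMap F E))
  {s : UnitaryGroup.adelicPair F E c N M JV JW →* adelicMpCont F (Fin n) (adelicGram F e TV TW)}

/-- **The finite Weil representation of a dual pair with trivial adelic pair group is trivial**: if `U(J_V ⊗ J_W)(𝔸_F)` is
a subsingleton (e.g. `N = 0`), then `ω_f(s_pair(k, u)) = 1` on `𝒮((𝔸_F^∞)^{N M})` for every `(k, u)` and every compatible
splitting `s` (`ω_f(1) = 1`: ★ `finRepMp_apply`, ★ `finPart_one`).
[cite: Weil1964, Chap. III n° 37–38 pp. 188–190] [cite: GelbartRogawski1991, §3.1 Prop. 3.1.1 p. 455] -/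
theorem finPairRep_eq_one_of_subsingleton [Subsingleton ↥(UnitaryGroup.adelicPair F E c N M JV JW)]
    (hs : (splittingDatum F E c N M e JV JW hcδ hδ hd hV hW hVd hWd hJV hJW).IsCompatible s)
    (p : UnitaryGroup.finAdelic F E c N JV × UnitaryGroup.finAdelic F E c M JW) :
    finPairRep F E c N M e JV JW hcδ hδ hd hV hW hVd hWd hJV hJW hs p = 1 := by
  unfold finPairRep
  rw [finRepMp_apply, pairSmall₁_finPairToAdelic_eq_one, map_one, finPart_one]

/-- in particular the `U(J_W)(𝔸_{F,f})`-member acts trivially: `ω_f(s_pair(1, u)) f = f`.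
[cite: Weil1964, Chap. III n° 37–38 pp. 188–190] [cite: GelbartRogawski1991, §3.1 Prop. 3.1.1 p. 455] -/
theorem finPairRepW_apply_of_subsingleton [Subsingleton ↥(UnitaryGroup.adelicPair F E c N M JV JW)]
    (hs : (splittingDatum F E c N M e JV JW hcδ hδ hd hV hW hVd hWd hJV hJW).IsCompatible s)
    (u : UnitaryGroup.finAdelic F E c M JW) (f : FinSB F (Fin N × Fin M)) :
    finPairRepW F E c N M e JV JW hcδ hδ hd hV hW hVd hWd hJV hJW hs u f = f := by
  rw [finPairRepW_apply, finPairRep_eq_one_of_subsingleton]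
  rfl

end Literature.NumberTheory.GelbartRogawski1991.UnitaryDualPair.WeilCoinv

/-! ## §2 Liu's carriers at a line for the empty `V`: the relation submodule does not depend on the line -/

namespace Literature.NumberTheory.Automorphic.Liu2021.Def411WeilCarriers

open Literature.NumberTheory.Automorphic Literature.NumberTheory.Automorphic.UnitaryGroup
open Literature.NumberTheory.Automorphic.Liu2021.Def411WeilCarriersDoubling
open Literature.NumberTheory.GelbartRogawski1991 Literature.NumberTheory.GelbartRogawski1991.UnitaryDualPair
open Literature.NumberTheory.GelbartRogawski1991.UnitaryDualPair.WeilCoinv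
open Literature.RepresentationTheory Literature.RepresentationTheory.HarrisKudlaSweet1996
open Literature.NumberTheory.GaloisRepresentations (HeckeCharacter)
open Literature.NumberTheory.Weil1964

section RankZero

variable (F E : Type) [Field F] [NumberField F] [Field E] [NumberField E] [Algebra F E]
variable (c : E ≃ₐ[F] E) {n : ℕ} (e : Fin 0 × Fin 1 ≃ Fin n)
variable (JV : Matrix (Fin 0) (Fin 0) E) {TV : Matrix (Fin 0) (Fin 0) F}
variable [Algebra.IsQuadraticExtension F E] {δ : E} (hcδ : c δ = -δ) (hδ : δ ≠ 0) {d : F}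
  (hd : δ * δ = algebraMap F E d) (hV : TV.IsSymm) (hVd : IsUnit TV.det) (hJV : JV = TV.map (algebraMap F E))
variable {s : ∀ a : Fˣ, UnitaryGroup.adelicPair F E c 0 1 JV (JW F E a) →* adelicMpCont F (Fin n) (adelicGram F e TV (TW F a))}
  (hs : ∀ a : Fˣ, (splittingDatum F E c 0 1 e JV (JW F E a) hcδ hδ hd hV (isSymm_TW F a) hVd (isUnit_det_TW F a) hJV
    (JW_eq F E a)).IsCompatible (s a))

/-- For the EMPTY `V` (`N = 0`) the relation submodule of `ω(μ, ε, χ)` realised at the line `⟨a⟩` — generated by the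
`ω_f(s_pair(1, u)) f − χ_W(u) • f`, `u ∈ U(⟨a⟩)(𝔸_{F,f})` — is `span {f − χ(u₀) • f : u₀ ∈ U(1)(𝔸_{F,f})}` (`ω_f = 1`,
`χ_W(u₀·1_W) = χ(u₀)`), hence contained in the relation submodule at any other line `⟨a′⟩`.
[cite: Liu2021, App. D §D.1 Step 3 (l. 5219–5221)] [cite: GelbartRogawski1991, §3.1–3.2 pp. 454–457] -/
theorem ker_le_ker_rankZero (χ : Chi F E c) (a a' : Fˣ) :
    TwistedCoinv.ker (finPairRepW F E c 0 1 e JV (JW F E a) hcδ hδ hd hV (isSymm_TW F a) hVd (isUnit_det_TW F a) hJV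
        (JW_eq F E a) (hs a)) (lineChar F E c a χ.1) ≤
      TwistedCoinv.ker (finPairRepW F E c 0 1 e JV (JW F E a') hcδ hδ hd hV (isSymm_TW F a') hVd (isUnit_det_TW F a') hJV
        (JW_eq F E a') (hs a')) (lineChar F E c a' χ.1) := by
  rw [TwistedCoinv.ker, Submodule.span_le]
  rintro _ ⟨⟨h, f⟩, rfl⟩
  obtain ⟨u, rfl⟩ := (lineCenterEquiv F E c a).surjective h
  have key := TwistedCoinv.sub_mem_ker (finPairRepW F E c 0 1 e JV (JW F E a') hcδ hδ hd hV (isSymm_TW F a') hVd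
    (isUnit_det_TW F a') hJV (JW_eq F E a') (hs a')) (lineChar F E c a' χ.1)
    (UnitaryGroup.finAdelicCenter F E c 1 (JW F E a') u) f
  rw [finPairRepW_apply_of_subsingleton, lineChar_finAdelicCenter] at key
  show _ ∈ TwistedCoinv.ker _ _
  dsimp only
  rw [finPairRepW_apply_of_subsingleton, lineCenterEquiv_apply, lineChar_finAdelicCenter]
  exact key

/-- **The relation submodules of `ω(μ, ε, χ)` at two lines coincide for the empty `V`** (both are
`span {f − χ(u₀) • f : u₀ ∈ U(1)(𝔸_{F,f})}` inside `𝒮((𝔸_F^∞)^{Fin 0 × Fin 1})`).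
[cite: Liu2021, App. D §D.1 Step 3 (l. 5219–5221)] [cite: GelbartRogawski1991, §3.1–3.2 pp. 454–457] -/
theorem ker_eq_ker_rankZero (χ : Chi F E c) (a a' : Fˣ) :
    TwistedCoinv.ker (finPairRepW F E c 0 1 e JV (JW F E a) hcδ hδ hd hV (isSymm_TW F a) hVd (isUnit_det_TW F a) hJV
        (JW_eq F E a) (hs a)) (lineChar F E c a χ.1) =
      TwistedCoinv.ker (finPairRepW F E c 0 1 e JV (JW F E a') hcδ hδ hd hV (isSymm_TW F a') hVd (isUnit_det_TW F a') hJV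
        (JW_eq F E a') (hs a')) (lineChar F E c a' χ.1) :=
  le_antisymm (ker_le_ker_rankZero F E c e JV hcδ hδ hd hV hVd hJV hs χ a a')
    (ker_le_ker_rankZero F E c e JV hcδ hδ hd hV hVd hJV hs χ a' a)

variable {G : Type*} [Group G] (ι : G →* UnitaryGroup.finAdelic F E c 0 JV)

/-- **Line-class transport for the empty `V`.**  For `N = 0` the `G`-representations `ω(μ, ε, χ)_f` realised at the
lines `⟨a⟩` and `⟨a′⟩` (any `a, a′ ∈ F^×`) admit an INJECTIVE intertwiner — indeed the identity of `𝒮(point)` descends to a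
linear isomorphism of the `χ_W`-coinvariants (`ker_eq_ker_rankZero`, Mathlib `Submodule.quotEquivOfEq`), and `G` acts
trivially on both sides through the trivial group `U(J_V)(𝔸_{F,f}) ≤ GL(Fin 0, 𝔸_{E,f})`.
[cite: Liu2021, Def. 4.11 (l. 2092–2096); App. D §D.1 Steps 2–3 (l. 5217–5221)] [cite: GelbartRogawski1991, §3.1 Prop. 3.1.1 p. 455] -/
theorem exists_intertwiningMap_injective_rankZero [TopologicalSpace G] (χ : Chi F E c) (a a' : Fˣ) :
    ∃ T : (rhoAtLine F E c 0 e JV hcδ hδ hd hV hVd hJV hs ι a χ).IntertwiningMap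
        (rhoAtLine F E c 0 e JV hcδ hδ hd hV hVd hJV hs ι a' χ), Function.Injective T := by
  refine ⟨LinearMap.intertwiningMap_of_isIntertwiningMap _ _
      (Submodule.quotEquivOfEq _ _ (ker_eq_ker_rankZero F E c e JV hcδ hδ hd hV hVd hJV hs χ a a')).toLinearMap
      (fun g v => ?_), ?_⟩
  · rw [rhoAtLine_apply, rhoAtLine_apply, Subsingleton.elim (ι g) 1, map_one, map_one]
    rfl
  · exact (Submodule.quotEquivOfEq _ _ (ker_eq_ker_rankZero F E c e JV hcδ hδ hd hV hVd hJV hs χ a a')).injective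

end RankZero

/-! ## §3 The `N′ = 0` instance of (C′) `rhoAtLine_lineClassTransport` at the CM datum -/

/-- **(C′) `rhoAtLine_lineClassTransport` at rank `N′ = 0`** — the body of ★ `rhoAtLine_lineClassTransport` with
`N′ := 0`, token for token, and WITHOUT the norm-class hypothesis `locF a = locF a′` (not needed in this corner): for `L`
CM, the empty frame `dV : Fin 0 → L`, a unitary splitting character `χ_V`, any `ιV : G →* U(diag dV)(𝔸_{L⁺,f})`, any
`χ ∈ Chi` and ANY two lines `a, a′`, there is an injective `G`-intertwiner `rhoAtLine … ιV a χ ↪ rhoAtLine … ιV a′ χ` at the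
`χ_V`-splittings (`isCompatible_chiSplittingLine`).  The consumer `rhoAtLine_lineClassTransport_holds` case-splits on
`N′` and uses this at `N′ = 0`. [cite: Liu2021, Def. 4.11 (l. 2092–2096); App. D §D.1 Steps 1–3 (l. 5215–5221)]
[cite: GelbartRogawski1991, §3.1 Prop. 3.1.1 p. 455] [cite: Weil1964, Chap. III n° 37–38 pp. 188–190] -/
theorem rhoAtLine_lineClassTransport_rankZero
    (L : Type) [Field L] [NumberField L] [IsCMField L] {n' : ℕ} (e₁ : Fin 0 × Fin 1 ≃ Fin n')
    (dV : Fin 0 → L) (hdV : ∀ i, IsCMField.complexConj L (dV i) = dV i) (hdV0 : ∀ i, dV i ≠ 0)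
    (χV : HeckeCharacter L) (hχu : χV.IsUnitary) (hχs : IsSplittingChar L 1 χV)
    {G : Type} [Group G] [TopologicalSpace G]
    (ιV : G →* finAdelic (↥(maximalRealSubfield L)) L (IsCMField.complexConj L) 0 (Matrix.diagonal dV))
    (χ : Chi (↥(maximalRealSubfield L)) L (IsCMField.complexConj L))
    (a a' : (↥(maximalRealSubfield L))ˣ) :
      ∃ e : (rhoAtLine (↥(maximalRealSubfield L)) L (IsCMField.complexConj L) 0 e₁ (Matrix.diagonal dV)
              (complexConj_imagUnit L) (imagUnit_ne_zero L) (imagUnit_mul_self L) (realDiagonal_isSymm L dV hdV)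
              (isUnit_det_realDiagonal L dV hdV hdV0) (realDiagonal_map L dV hdV).symm
              (fun b => isCompatible_chiSplittingLine L e₁ dV hdV hdV0 χV hχu hχs
                (TW (↥(maximalRealSubfield L)) b) (isSymm_TW (↥(maximalRealSubfield L)) b)
                (isUnit_det_TW (↥(maximalRealSubfield L)) b) (JW (↥(maximalRealSubfield L)) L b)
                (JW_eq (↥(maximalRealSubfield L)) L b))
              ιV a χ).IntertwiningMap
            (rhoAtLine (↥(maximalRealSubfield L)) L (IsCMField.complexConj L) 0 e₁ (Matrix.diagonal dV)
              (complexConj_imagUnit L) (imagUnit_ne_zero L) (imagUnit_mul_self L) (realDiagonal_isSymm L dV hdV)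
              (isUnit_det_realDiagonal L dV hdV hdV0) (realDiagonal_map L dV hdV).symm
              (fun b => isCompatible_chiSplittingLine L e₁ dV hdV hdV0 χV hχu hχs
                (TW (↥(maximalRealSubfield L)) b) (isSymm_TW (↥(maximalRealSubfield L)) b)
                (isUnit_det_TW (↥(maximalRealSubfield L)) b) (JW (↥(maximalRealSubfield L)) L b)
                (JW_eq (↥(maximalRealSubfield L)) L b))
              ιV a' χ),
        Function.Injective e :=
  exists_intertwiningMap_injective_rankZero (↥(maximalRealSubfield L)) L (IsCMField.complexConj L) e₁
    (Matrix.diagonal dV) (complexConj_imagUnit L) (imagUnit_ne_zero L) (imagUnit_mul_self L)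
    (realDiagonal_isSymm L dV hdV) (isUnit_det_realDiagonal L dV hdV hdV0) (realDiagonal_map L dV hdV).symm
    (fun b => isCompatible_chiSplittingLine L e₁ dV hdV hdV0 χV hχu hχs
      (TW (↥(maximalRealSubfield L)) b) (isSymm_TW (↥(maximalRealSubfield L)) b)
      (isUnit_det_TW (↥(maximalRealSubfield L)) b) (JW (↥(maximalRealSubfield L)) L b)
      (JW_eq (↥(maximalRealSubfield L)) L b))
    ιV χ a a'

/-- **(C′) restricted to `N′ = 0` follows** — the same with (C′)'s (here idle) hypothesis `locF a = locF a′` in place, so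
that a consumer can `exact` it in the `N′ = 0` branch of a case split with (C′)'s binders untouched.
[cite: Liu2021, Def. 4.11 (l. 2092–2096); App. D §D.1 Steps 1–3 (l. 5215–5221)] [cite: GelbartRogawski1991, §3.1 Prop. 3.1.1 p. 455] -/
theorem rhoAtLine_lineClassTransport_rankZero_of_locF_eq
    (L : Type) [Field L] [NumberField L] [IsCMField L] {n' : ℕ} (e₁ : Fin 0 × Fin 1 ≃ Fin n')
    (dV : Fin 0 → L) (hdV : ∀ i, IsCMField.complexConj L (dV i) = dV i) (hdV0 : ∀ i, dV i ≠ 0)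
    (χV : HeckeCharacter L) (hχu : χV.IsUnitary) (hχs : IsSplittingChar L 1 χV)
    {G : Type} [Group G] [TopologicalSpace G]
    (ιV : G →* finAdelic (↥(maximalRealSubfield L)) L (IsCMField.complexConj L) 0 (Matrix.diagonal dV))
    (χ : Chi (↥(maximalRealSubfield L)) L (IsCMField.complexConj L))
    (a a' : (↥(maximalRealSubfield L))ˣ)
    (_h : locF (↥(maximalRealSubfield L)) (imagUnitSq L) a = locF (↥(maximalRealSubfield L)) (imagUnitSq L) a') :
      ∃ e : (rhoAtLine (↥(maximalRealSubfield L)) L (IsCMField.complexConj L) 0 e₁ (Matrix.diagonal dV)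
              (complexConj_imagUnit L) (imagUnit_ne_zero L) (imagUnit_mul_self L) (realDiagonal_isSymm L dV hdV)
              (isUnit_det_realDiagonal L dV hdV hdV0) (realDiagonal_map L dV hdV).symm
              (fun b => isCompatible_chiSplittingLine L e₁ dV hdV hdV0 χV hχu hχs
                (TW (↥(maximalRealSubfield L)) b) (isSymm_TW (↥(maximalRealSubfield L)) b)
                (isUnit_det_TW (↥(maximalRealSubfield L)) b) (JW (↥(maximalRealSubfield L)) L b)
                (JW_eq (↥(maximalRealSubfield L)) L b))
              ιV a χ).IntertwiningMap
            (rhoAtLine (↥(maximalRealSubfield L)) L (IsCMField.complexConj L) 0 e₁ (Matrix.diagonal dV)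
              (complexConj_imagUnit L) (imagUnit_ne_zero L) (imagUnit_mul_self L) (realDiagonal_isSymm L dV hdV)
              (isUnit_det_realDiagonal L dV hdV hdV0) (realDiagonal_map L dV hdV).symm
              (fun b => isCompatible_chiSplittingLine L e₁ dV hdV hdV0 χV hχu hχs
                (TW (↥(maximalRealSubfield L)) b) (isSymm_TW (↥(maximalRealSubfield L)) b)
                (isUnit_det_TW (↥(maximalRealSubfield L)) b) (JW (↥(maximalRealSubfield L)) L b)
                (JW_eq (↥(maximalRealSubfield L)) L b))
              ιV a' χ),
        Function.Injective e :=
  rhoAtLine_lineClassTransport_rankZero L e₁ dV hdV hdV0 χV hχu hχs ιV χ a a'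

end Literature.NumberTheory.Automorphic.Liu2021.Def411WeilCarriers

end
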